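import Literature.Probability.RandomPlanarGeometry.RectangleSCVertex
import Literature.Probability.RandomPlanarGeometry.ModulusSymmetry
import HarnessLib

/-!
# The Schwarz–Christoffel map of the rectangle, III: symmetries and the remaining boundary values

Third input of the proof of `rectangle_crossRatio_eq_elliptic` (Bollobás–Riordan (2006), Ch. 7
§7.1, p. 185), continuing `RectangleSCIntegrand` (`F_k = scrFun k`, `F_k′ = f_k`, `F_k` odd,
`F_k ∘ conj = conj ∘ F_k`, `F_k = ellipticF (k²)` on `(-1,1)`) and `RectangleSCVertex` (boundary
value `K = K(k²)` at `1`, `K + i V_k(x)` at `x ∈ (1, 1/k)`). Throughout `0 < k < 1`,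
`K = ellipticK (k²)`, `H = ellipticK (1 - k²)`.

* **The Möbius symmetry** `σ(w) = -1/(k w)` (`scrMoeb`), the involution of `ℍₒ` exchanging the
  prevertices `1 ↔ -1/k`, `-1 ↔ 1/k` (rotation of the rectangle by `π`): `f_k(σ w) σ′(w) = -f_k(w)`
  on `ℍₒ` (`scrDeriv_scrMoeb_mul`: both sides are holomorphic with equal squares — a rational
  identity — so they agree up to a sign constant on the connected `ℍₒ`,
  `IsPreconnected.eq_or_eq_neg_of_sq_eq`, fixed at the fixed point `i/√k` of `σ`), hence
  `F_k(σ w) + F_k(w)` is constant on `ℍₒ`.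
* **The imaginary axis**: `F_k(iy) = i ∫₀ʸ dt/√((1+t²)(1+k²t²))` (`scrFun_I_mul`), which tends to
  `iH` as `y → ∞` (`RectangleModulusElliptic.integral_Ioi_imagAxisIntegrand_eq_ellipticK`), while
  `F_k(σ(iy)) = F_k(i/(ky)) → F_k(0) = 0`; so the constant is `iH`:
  `F_k(σ w) + F_k(w) = iH` (`scrFun_scrMoeb_add`), and `F_k(i/√k) = iH/2`.
* **Boundary values** (transport along `σ` and along the reflection `ρ(w) = -w̄`,
  `F_k ∘ ρ = -conj ∘ F_k`): `-K` at `-1`, `±K + iH` at `±1/k`, `iH - ellipticF (k²) (σ x)` at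
  `|x| > 1/k` (top side), `-K + i V_k(-x)` at `x ∈ (-1/k, -1)` (left side), `iH` at `∞`; and the
  **height bound** `V_k(x) + V_k(1/(kx)) = H` on `(1, 1/k)` (`scrV_add_scrV_inv`, from the
  anti-holomorphic symmetry `F_k(1/(k w̄)) = conj F_k(w) + iH`, the reflection of the rectangle in
  its horizontal midline), whence `0 ≤ V_k ≤ H`.

## References

* B. Bollobás, O. Riordan, *Percolation*, CUP (2006), Ch. 7 §7.1, p. 185.
* L. V. Ahlfors, *Complex Analysis*, 3rd ed. (1979), Ch. 6 §2.3 (mapping on a rectangle; the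
  symmetries of `sn`).
* Z. Nehari, *Conformal Mapping*, McGraw-Hill (1952), Ch. V §6.
-/

open Set Filter Topology Complex MeasureTheory Metric
open scoped Real Interval ComplexConjugate
open UpperHalfPlane (upperHalfPlaneSet isOpen_upperHalfPlaneSet)

noncomputable section

namespace Literature.Probability.RandomPlanarGeometry

variable {k : ℝ}

/-! ### The Möbius involution `σ(w) = -1/(kw)` of `ℍₒ` -/

/-- The Möbius involution `σ(w) = -1/(k w)` of `ℍₒ` (`k > 0`), exchanging the prevertices
`1 ↔ -1/k` and `-1 ↔ 1/k` and fixing `i/√k`; it induces the rotation by `π` of the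
Schwarz–Christoffel rectangle. [folklore] -/
def scrMoeb (k : ℝ) (w : ℂ) : ℂ := -((k : ℂ) * w)⁻¹

/-- `σ` maps `ℍₒ` into itself. [folklore] -/
theorem scrMoeb_mem (hk0 : 0 < k) {w : ℂ} (hw : w ∈ upperHalfPlaneSet) : scrMoeb k w ∈ upperHalfPlaneSet := by
  have hw' : (0 : ℝ) < w.im := hw
  have hne : (k : ℂ) * w ≠ 0 := mul_ne_zero (ofReal_ne_zero.2 hk0.ne') (ne_zero_of_mem_upperHalfPlaneSet hw)
  show 0 < (scrMoeb k w).im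
  rw [scrMoeb, neg_im, inv_im, neg_div, neg_neg, mul_im, ofReal_re, ofReal_im, zero_mul, add_zero]
  exact div_pos (mul_pos hk0 hw') (normSq_pos.2 hne)

/-- `σ` is an involution (away from `0`). [folklore] -/
theorem scrMoeb_scrMoeb (hk : k ≠ 0) {w : ℂ} (hw : w ≠ 0) : scrMoeb k (scrMoeb k w) = w := by
  have hk' : (k : ℂ) ≠ 0 := ofReal_ne_zero.2 hk
  unfold scrMoeb
  field_simp

/-- `σ′(w) = 1/(k w²)`. [folklore] -/
theorem hasDerivAt_scrMoeb (hk : k ≠ 0) {w : ℂ} (hw : w ≠ 0) :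
    HasDerivAt (scrMoeb k) ((k : ℂ)⁻¹ * (w ^ 2)⁻¹) w := by
  have hk' : (k : ℂ) ≠ 0 := ofReal_ne_zero.2 hk
  have h := ((hasDerivAt_inv hw).const_mul ((k : ℂ)⁻¹)).neg
  have hfun : scrMoeb k = fun w => -((k : ℂ)⁻¹ * w⁻¹) := by
    funext w; rw [scrMoeb, mul_inv]
  rw [hfun]
  exact h.congr_deriv (by ring)

/-- The fixed point `i/√k` of `σ` lies in `ℍₒ`. [folklore] -/
theorem I_mul_inv_sqrt_mem (hk0 : 0 < k) : I * ((Real.sqrt k)⁻¹ : ℝ) ∈ upperHalfPlaneSet := by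
  show 0 < (I * ((Real.sqrt k)⁻¹ : ℝ)).im
  simpa using Real.sqrt_pos.2 hk0

/-- `(i/√k)² = -1/k`. [folklore] -/
theorem I_mul_inv_sqrt_sq (hk0 : 0 < k) : (I * ((Real.sqrt k)⁻¹ : ℝ)) ^ 2 = -((k : ℂ)⁻¹) := by
  rw [mul_pow, I_sq, ← ofReal_pow, inv_pow, Real.sq_sqrt hk0.le]
  push_cast
  ring

/-- `i/√k` is a fixed point of `σ`. [folklore] -/
theorem scrMoeb_fixed (hk0 : 0 < k) : scrMoeb k (I * ((Real.sqrt k)⁻¹ : ℝ)) = I * ((Real.sqrt k)⁻¹ : ℝ) := by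
  have hs : Real.sqrt k ≠ 0 := (Real.sqrt_pos.2 hk0).ne'
  have hsC : ((Real.sqrt k : ℝ) : ℂ) ≠ 0 := ofReal_ne_zero.2 hs
  have hk : (k : ℂ) = ((Real.sqrt k : ℝ) : ℂ) ^ 2 := by rw [← ofReal_pow, Real.sq_sqrt hk0.le]
  have e : ((Real.sqrt k : ℝ) : ℂ) ^ 2 * (I * ((Real.sqrt k : ℝ) : ℂ)⁻¹) = ((Real.sqrt k : ℝ) : ℂ) * I := by
    calc _ = ((Real.sqrt k : ℝ) : ℂ) * I * (((Real.sqrt k : ℝ) : ℂ) * ((Real.sqrt k : ℝ) : ℂ)⁻¹) := by ring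
      _ = _ := by rw [mul_inv_cancel₀ hsC, mul_one]
  rw [scrMoeb, hk]
  push_cast
  rw [e, mul_inv, inv_I]
  ring

/-- **Derivative bookkeeping for the symmetry**: `f_k(σ w) σ′(w) = -f_k(w)` on `ℍₒ`. The squares of
both sides agree (a rational identity), both sides are holomorphic and zero-free on the connected
set `ℍₒ`, so they agree up to a constant sign, which is `+` at the fixed point `i/√k`
(`σ′(i/√k) = -1`). [folklore] -/
theorem scrDeriv_scrMoeb_mul (hk0 : 0 < k) (hk1 : k < 1) {w : ℂ} (hw : w ∈ upperHalfPlaneSet) :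
    scrDeriv k (scrMoeb k w) * ((k : ℂ)⁻¹ * (w ^ 2)⁻¹) = -scrDeriv k w := by
  set φ₁ : ℂ → ℂ := fun w => scrDeriv k (scrMoeb k w) * ((k : ℂ)⁻¹ * (w ^ 2)⁻¹) with hφ₁
  set φ₂ : ℂ → ℂ := fun w => -scrDeriv k w with hφ₂
  have hkC : (k : ℂ) ≠ 0 := ofReal_ne_zero.2 hk0.ne'
  have hsq_f : ∀ z ∈ scrDomain, scrDeriv k z ^ 2 = (1 - z ^ 2)⁻¹ * (1 - ((k : ℂ) * z) ^ 2)⁻¹ := by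
    intro z hz
    have h1 := slitPlane_ne_zero (one_sub_sq_mem_slitPlane hz)
    have h2 := slitPlane_ne_zero (one_sub_mul_sq_mem_slitPlane hk0.le hk1.le hz)
    rw [scrDeriv, mul_pow, sq, sq ((1 - ((k : ℂ) * z) ^ 2) ^ _), ← cpow_add _ _ h1, ← cpow_add _ _ h2,
      show -(1 / 2 : ℂ) + -(1 / 2 : ℂ) = -1 by norm_num, cpow_neg_one, cpow_neg_one]
  have hcont₁ : ContinuousOn φ₁ upperHalfPlaneSet := by
    intro z hz
    have hz0 := ne_zero_of_mem_upperHalfPlaneSet hz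
    have ha : ContinuousAt (fun w => scrDeriv k (scrMoeb k w)) z :=
      ContinuousAt.comp (f := scrMoeb k) (g := scrDeriv k)
        ((continuousOn_scrDeriv hk0.le hk1.le).continuousAt
          (isOpen_scrDomain.mem_nhds (upperHalfPlaneSet_subset_scrDomain (scrMoeb_mem hk0 hz))))
        (hasDerivAt_scrMoeb hk0.ne' hz0).continuousAt
    have hb : ContinuousAt (fun w : ℂ => (k : ℂ)⁻¹ * (w ^ 2)⁻¹) z :=
      continuousAt_const.mul ((continuousAt_pow z 2).inv₀ (pow_ne_zero 2 hz0))
    exact (ha.mul hb).continuousWithinAt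
  have hcont₂ : ContinuousOn φ₂ upperHalfPlaneSet :=
    ((continuousOn_scrDeriv hk0.le hk1.le).mono upperHalfPlaneSet_subset_scrDomain).neg
  have hsq : EqOn (φ₁ ^ 2) (φ₂ ^ 2) upperHalfPlaneSet := by
    intro z hz
    have hz0 := ne_zero_of_mem_upperHalfPlaneSet hz
    have hσ := upperHalfPlaneSet_subset_scrDomain (scrMoeb_mem hk0 hz)
    have hzD := upperHalfPlaneSet_subset_scrDomain hz
    have h1 := slitPlane_ne_zero (one_sub_sq_mem_slitPlane hzD)
    have h2 := slitPlane_ne_zero (one_sub_mul_sq_mem_slitPlane hk0.le hk1.le hzD)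
    have h3 := slitPlane_ne_zero (one_sub_sq_mem_slitPlane hσ)
    have h4 := slitPlane_ne_zero (one_sub_mul_sq_mem_slitPlane hk0.le hk1.le hσ)
    show φ₁ z ^ 2 = φ₂ z ^ 2
    have haux : (1 - (scrMoeb k z) ^ 2) * (1 - ((k : ℂ) * scrMoeb k z) ^ 2) * ((k : ℂ) * z ^ 2) ^ 2 =
        (1 - z ^ 2) * (1 - ((k : ℂ) * z) ^ 2) := by
      unfold scrMoeb; field_simp; ring
    simp only [hφ₁, hφ₂, neg_sq, mul_pow]
    rw [hsq_f _ hσ, hsq_f _ hzD]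
    conv_rhs => rw [← mul_inv, ← haux]
    simp only [mul_inv, mul_pow, inv_pow]
  have hne₂ : ∀ {z}, z ∈ upperHalfPlaneSet → φ₂ z ≠ 0 := fun hz =>
    neg_ne_zero.2 (scrDeriv_ne_zero hk0.le hk1.le (upperHalfPlaneSet_subset_scrDomain hz))
  rcases (convex_halfSpace_im_gt 0).isPreconnected.eq_or_eq_neg_of_sq_eq hcont₁ hcont₂ hsq hne₂ with h | h
  · exact h hw
  · exfalso
    have hw₀m := I_mul_inv_sqrt_mem hk0
    have key := h hw₀m
    have hval : φ₁ (I * ((Real.sqrt k)⁻¹ : ℝ)) = φ₂ (I * ((Real.sqrt k)⁻¹ : ℝ)) := by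
      show scrDeriv k (scrMoeb k (I * ((Real.sqrt k)⁻¹ : ℝ))) *
          ((k : ℂ)⁻¹ * ((I * ((Real.sqrt k)⁻¹ : ℝ)) ^ 2)⁻¹) = -scrDeriv k (I * ((Real.sqrt k)⁻¹ : ℝ))
      rw [scrMoeb_fixed hk0, I_mul_inv_sqrt_sq hk0, inv_neg, inv_inv, mul_neg, inv_mul_cancel₀ hkC]
      ring
    have h2 : φ₂ (I * ((Real.sqrt k)⁻¹ : ℝ)) = 0 := by
      have k2 : φ₂ (I * ((Real.sqrt k)⁻¹ : ℝ)) = -φ₂ (I * ((Real.sqrt k)⁻¹ : ℝ)) := by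
        have := key
        rw [hval] at this
        exact this
      linear_combination k2 / 2
    exact hne₂ hw₀m h2

/-! ### `F_k ∘ σ + F_k` is constant on `ℍₒ` -/

/-- `F_k(σ w) + F_k(w)` has zero derivative, hence is constant, on `ℍₒ`. [folklore] -/
theorem scrFun_scrMoeb_add_eq (hk0 : 0 < k) (hk1 : k < 1) {w w' : ℂ} (hw : w ∈ upperHalfPlaneSet)
    (hw' : w' ∈ upperHalfPlaneSet) :
    scrFun k (scrMoeb k w) + scrFun k w = scrFun k (scrMoeb k w') + scrFun k w' := by
  set D : ℂ → ℂ := fun w => scrFun k (scrMoeb k w) + scrFun k w with hD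
  have hderiv : ∀ z ∈ upperHalfPlaneSet, HasDerivAt D 0 z := by
    intro z hz
    have hz0 := ne_zero_of_mem_upperHalfPlaneSet hz
    have h1 : HasDerivAt (fun w => scrFun k (scrMoeb k w))
        (scrDeriv k (scrMoeb k z) * ((k : ℂ)⁻¹ * (z ^ 2)⁻¹)) z :=
      (hasDerivAt_scrFun_of_mem hk0.le hk1.le (scrMoeb_mem hk0 hz)).comp z (hasDerivAt_scrMoeb hk0.ne' hz0)
    have h := h1.add (hasDerivAt_scrFun_of_mem hk0.le hk1.le hz)
    rwa [scrDeriv_scrMoeb_mul hk0 hk1 hz, neg_add_cancel] at h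
  exact isOpen_upperHalfPlaneSet.is_const_of_deriv_eq_zero (convex_halfSpace_im_gt 0).isPreconnected
    (fun z hz => (hderiv z hz).differentiableAt.differentiableWithinAt)
    (fun z hz => (hderiv z hz).deriv) hw hw'

/-! ### The imaginary axis -/

/-- On the imaginary axis the kernel is real: `f_k(i s y) = φ_k(s y)`,
`φ_k(t) = 1/√((1+t²)(1+k²t²))` (`imagAxisIntegrand`). [folklore] -/
theorem scrKernel_I_mul (k : ℝ) {y : ℝ} (s : ℝ) : scrKernel k (I * y) s = (imagAxisIntegrand k (s * y) : ℝ) := by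
  have h1 : 0 ≤ 1 + (s * y) ^ 2 := by positivity
  have h2 : 0 ≤ 1 + (k * (s * y)) ^ 2 := by positivity
  have h1' : 0 < 1 + (s * y) ^ 2 := by positivity
  have h2' : 0 < 1 + k ^ 2 * (s * y) ^ 2 := by positivity
  rw [scrKernel, scrDeriv, neg_half_eq_cast,
    show (1 : ℂ) - ((s : ℂ) * (I * y)) ^ 2 = ((1 + (s * y) ^ 2 : ℝ) : ℂ) by
      push_cast; rw [mul_pow, mul_pow, I_sq]; ring,
    show (1 : ℂ) - ((k : ℂ) * ((s : ℂ) * (I * y))) ^ 2 = ((1 + (k * (s * y)) ^ 2 : ℝ) : ℂ) by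
      push_cast; rw [mul_pow, mul_pow, mul_pow, I_sq]; ring,
    ← ofReal_cpow h1, ← ofReal_cpow h2, ← ofReal_mul]
  congr 1
  rw [imagAxisIntegrand, mul_pow k]
  conv_rhs => rw [Real.sqrt_eq_rpow, one_div, ← Real.rpow_neg (by positivity), Real.mul_rpow h1 h2'.le]

/-- **The map on the imaginary axis**: `F_k(iy) = i ∫₀ʸ dt/√((1+t²)(1+k²t²))`. [cite: BollobasRiordan2006, Ch. 7 §7.1 p. 185] -/
theorem scrFun_I_mul (k : ℝ) (y : ℝ) :
    scrFun k (I * y) = I * ((∫ t in (0 : ℝ)..y, imagAxisIntegrand k t : ℝ) : ℂ) := by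
  have hI : scrAux k (I * y) = ((∫ s in (0 : ℝ)..1, imagAxisIntegrand k (y * s) : ℝ) : ℂ) := by
    rw [scrAux, ← intervalIntegral.integral_ofReal]
    refine intervalIntegral.integral_congr fun s _ => ?_
    rw [scrKernel_I_mul, mul_comm s y]
  have hsub : y * ∫ s in (0 : ℝ)..1, imagAxisIntegrand k (y * s) = ∫ t in (0 : ℝ)..y, imagAxisIntegrand k t := by
    rw [intervalIntegral.mul_integral_comp_mul_left, mul_zero, mul_one]
  rw [scrFun, hI, ← hsub]
  push_cast
  ring

/-- `F_k(iy) → iH`, `H = K(1-k²)`, as `y → ∞`. [folklore] -/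
theorem tendsto_scrFun_I_mul_atTop (hk0 : 0 < k) (hk1 : k < 1) :
    Tendsto (fun y : ℝ => scrFun k (I * y)) atTop (𝓝 (I * (ellipticK (1 - k ^ 2) : ℂ))) := by
  have h := ((continuous_ofReal.tendsto _).comp (tendsto_integral_imagAxisIntegrand hk0 hk1)).const_mul I
  refine h.congr fun y => ?_
  simp only [Function.comp_apply, scrFun_I_mul]

/-- `σ(iy) = i/(ky)`. [folklore] -/
theorem scrMoeb_I_mul (k y : ℝ) : scrMoeb k (I * y) = I * (((k * y)⁻¹ : ℝ) : ℂ) := by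
  rw [scrMoeb]
  push_cast
  rw [mul_inv, mul_inv, inv_I]
  ring

/-- `F_k(σ(iy)) = F_k(i/(ky)) → F_k(0) = 0` as `y → ∞`. [folklore] -/
theorem tendsto_scrFun_scrMoeb_I_mul_atTop (hk0 : 0 < k) (hk1 : k ≤ 1) :
    Tendsto (fun y : ℝ => scrFun k (scrMoeb k (I * y))) atTop (𝓝 0) := by
  have h1 : Tendsto (fun y : ℝ => (k * y)⁻¹) atTop (𝓝 0) :=
    tendsto_inv_atTop_zero.comp (tendsto_id.const_mul_atTop hk0)
  have h2 : Tendsto (fun y : ℝ => I * (((k * y)⁻¹ : ℝ) : ℂ)) atTop (𝓝 (I * ((0 : ℝ) : ℂ))) :=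
    ((continuous_ofReal.tendsto _).comp h1).const_mul I
  rw [ofReal_zero, mul_zero] at h2
  have h3 : ContinuousAt (scrFun k) 0 :=
    (continuousOn_scrFun hk0.le hk1).continuousAt (isOpen_scrDomain.mem_nhds zero_mem_scrDomain)
  have h4 := h3.tendsto.comp h2
  rw [scrFun_zero] at h4
  refine h4.congr fun y => ?_
  simp only [Function.comp_apply, scrMoeb_I_mul]

/-- **The Möbius symmetry of the Schwarz–Christoffel map**: `F_k(σ w) + F_k(w) = iH` on `ℍₒ`,
`H = K(1-k²)` (the rotation of the rectangle by `π` about its centre `iH/2`). [cite: BollobasRiordan2006, Ch. 7 §7.1 p. 185] -/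
theorem scrFun_scrMoeb_add (hk0 : 0 < k) (hk1 : k < 1) {w : ℂ} (hw : w ∈ upperHalfPlaneSet) :
    scrFun k (scrMoeb k w) + scrFun k w = I * (ellipticK (1 - k ^ 2) : ℂ) := by
  have hlim : Tendsto (fun y : ℝ => scrFun k (scrMoeb k (I * y)) + scrFun k (I * y)) atTop
      (𝓝 (0 + I * (ellipticK (1 - k ^ 2) : ℂ))) :=
    (tendsto_scrFun_scrMoeb_I_mul_atTop hk0 hk1.le).add (tendsto_scrFun_I_mul_atTop hk0 hk1)
  rw [zero_add] at hlim
  have hconst : ∀ᶠ y : ℝ in atTop, scrFun k (scrMoeb k (I * y)) + scrFun k (I * y) =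
      scrFun k (scrMoeb k w) + scrFun k w := by
    filter_upwards [eventually_gt_atTop 0] with y hy
    have hy' : I * (y : ℂ) ∈ upperHalfPlaneSet := by show 0 < (I * (y : ℂ)).im; simpa using hy
    exact scrFun_scrMoeb_add_eq hk0 hk1 hy' hw
  exact tendsto_nhds_unique (tendsto_const_nhds.congr' (hconst.mono fun y hy => hy.symm)) hlim

/-- Transport along `σ`: `F_k(w) = iH - F_k(σ w)` on `ℍₒ`. [folklore] -/
theorem scrFun_eq_sub_scrFun_scrMoeb (hk0 : 0 < k) (hk1 : k < 1) {w : ℂ} (hw : w ∈ upperHalfPlaneSet) :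
    scrFun k w = I * (ellipticK (1 - k ^ 2) : ℂ) - scrFun k (scrMoeb k w) := by
  rw [← scrFun_scrMoeb_add hk0 hk1 hw]; ring

/-- **The centre**: `F_k(i/√k) = iH/2` (the fixed point of `σ` goes to the centre of symmetry). [folklore] -/
theorem scrFun_fixed (hk0 : 0 < k) (hk1 : k < 1) :
    scrFun k (I * ((Real.sqrt k)⁻¹ : ℝ)) = I * (ellipticK (1 - k ^ 2) : ℂ) / 2 := by
  have h := scrFun_scrMoeb_add hk0 hk1 (I_mul_inv_sqrt_mem hk0)
  rw [scrMoeb_fixed hk0] at h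
  linear_combination h / 2

/-! ### Transport of boundary values along `σ` and along the reflection `ρ(w) = -w̄` -/

/-- `σ w → σ x` within `ℍₒ` as `w → x ≠ 0` within `ℍₒ`. [folklore] -/
theorem tendsto_scrMoeb_nhdsWithin (hk0 : 0 < k) {x : ℂ} (hx : x ≠ 0) :
    Tendsto (scrMoeb k) (𝓝[upperHalfPlaneSet] x) (𝓝[upperHalfPlaneSet] (scrMoeb k x)) :=
  tendsto_nhdsWithin_of_tendsto_nhds_of_eventually_within _
    ((hasDerivAt_scrMoeb hk0.ne' hx).continuousAt.tendsto.mono_left nhdsWithin_le_nhds)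
    (eventually_mem_nhdsWithin.mono fun _ hw => scrMoeb_mem hk0 hw)

/-- `σ w → 0` within `ℍₒ` as `w → ∞` within `ℍₒ`. [folklore] -/
theorem tendsto_scrMoeb_atInfty (hk0 : 0 < k) :
    Tendsto (scrMoeb k) (cocompact ℂ ⊓ 𝓟 upperHalfPlaneSet) (𝓝[upperHalfPlaneSet] 0) := by
  refine tendsto_nhdsWithin_of_tendsto_nhds_of_eventually_within _ ?_ ?_
  · refine Tendsto.mono_left ?_ inf_le_left
    rw [tendsto_zero_iff_norm_tendsto_zero]
    have h1 : Tendsto (fun w : ℂ => ‖(k : ℂ) * w‖) (cocompact ℂ) atTop := by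
      simp only [norm_mul, Complex.norm_real, Real.norm_eq_abs, abs_of_pos hk0]
      exact tendsto_norm_cocompact_atTop.const_mul_atTop hk0
    refine (tendsto_inv_atTop_zero.comp h1).congr fun w => ?_
    simp [scrMoeb, norm_inv]
  · exact eventually_inf_principal.2 (Eventually.of_forall fun w hw => scrMoeb_mem hk0 hw)

/-- **Transport of a boundary value along `σ`**: if `F_k → L` at `σ x` (`x ≠ 0` real) within `ℍₒ`,
then `F_k → iH - L` at `x` within `ℍₒ`. [folklore] -/
theorem tendsto_scrFun_of_scrMoeb (hk0 : 0 < k) (hk1 : k < 1) {x : ℂ} (hx : x ≠ 0) {L : ℂ}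
    (h : Tendsto (scrFun k) (𝓝[upperHalfPlaneSet] (scrMoeb k x)) (𝓝 L)) :
    Tendsto (scrFun k) (𝓝[upperHalfPlaneSet] x) (𝓝 (I * (ellipticK (1 - k ^ 2) : ℂ) - L)) := by
  have h2 := (tendsto_const_nhds (x := I * (ellipticK (1 - k ^ 2) : ℂ))).sub
    (h.comp (tendsto_scrMoeb_nhdsWithin hk0 hx))
  exact h2.congr' (eventually_mem_nhdsWithin.mono fun w hw => (scrFun_eq_sub_scrFun_scrMoeb hk0 hk1 hw).symm)

/-- **Boundary value at `∞`**: `F_k(w) → iH` as `w → ∞` within `ℍₒ` (the midpoint of the top side). [cite: BollobasRiordan2006, Ch. 7 §7.1 p. 185] -/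
theorem tendsto_scrFun_atInfty (hk0 : 0 < k) (hk1 : k < 1) :
    Tendsto (scrFun k) (cocompact ℂ ⊓ 𝓟 upperHalfPlaneSet) (𝓝 (I * (ellipticK (1 - k ^ 2) : ℂ))) := by
  have h2 := (tendsto_scrFun_zero hk0.le hk1.le).comp (tendsto_scrMoeb_atInfty hk0)
  have h3 := (tendsto_const_nhds (x := I * (ellipticK (1 - k ^ 2) : ℂ))).sub h2
  rw [sub_zero] at h3
  refine h3.congr' ?_
  exact eventually_inf_principal.2 (Eventually.of_forall fun w hw => (scrFun_eq_sub_scrFun_scrMoeb hk0 hk1 hw).symm)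

/-- The reflection `ρ(w) = -w̄` tends to `-x̄` within `ℍₒ` as `w → x` within `ℍₒ`. [folklore] -/
theorem tendsto_neg_conj_nhdsWithin (x : ℂ) :
    Tendsto (fun w : ℂ => -conj w) (𝓝[upperHalfPlaneSet] x) (𝓝[upperHalfPlaneSet] (-conj x)) :=
  tendsto_nhdsWithin_of_tendsto_nhds_of_eventually_within _
    ((continuous_conj.neg.tendsto x).mono_left nhdsWithin_le_nhds)
    (eventually_mem_nhdsWithin.mono fun _ hw => neg_conj_mem_upperHalfPlaneSet hw)

/-- **Transport of a boundary value along the reflection `ρ(w) = -w̄`**: if `F_k → L` at the real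
point `-x` within `ℍₒ`, then `F_k → -conj L` at `x` within `ℍₒ` (`F_k ∘ ρ = -conj ∘ F_k`). [folklore] -/
theorem tendsto_scrFun_of_reflect (hk0 : 0 ≤ k) (hk1 : k ≤ 1) {x : ℝ} {L : ℂ}
    (h : Tendsto (scrFun k) (𝓝[upperHalfPlaneSet] ((-x : ℝ) : ℂ)) (𝓝 L)) :
    Tendsto (scrFun k) (𝓝[upperHalfPlaneSet] (x : ℂ)) (𝓝 (-conj L)) := by
  have h1 := tendsto_neg_conj_nhdsWithin (x : ℂ)
  rw [conj_ofReal, show -(x : ℂ) = ((-x : ℝ) : ℂ) by push_cast; ring] at h1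
  have h2 := ((continuous_conj.neg.tendsto L).comp (h.comp h1))
  refine h2.congr' (eventually_mem_nhdsWithin.mono fun w hw => ?_)
  show -conj (scrFun k (-conj w)) = scrFun k w
  rw [scrFun_neg_conj hk0 hk1 (upperHalfPlaneSet_subset_scrDomain hw)]
  simp

/-! ### The remaining boundary values -/

/-- **Boundary value at the prevertex `-1`**: the corner `-K`. [cite: BollobasRiordan2006, Ch. 7 §7.1 p. 185] -/
theorem tendsto_scrFun_neg_one (hk0 : 0 < k) (hk1 : k < 1) :
    Tendsto (scrFun k) (𝓝[upperHalfPlaneSet] (-1)) (𝓝 (-(ellipticK (k ^ 2) : ℂ))) := by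
  have h := tendsto_scrFun_one hk0 hk1
  rw [show (1 : ℂ) = ((-(-1 : ℝ) : ℝ) : ℂ) by push_cast; ring] at h
  have h2 := tendsto_scrFun_of_reflect hk0.le hk1.le h
  rw [conj_ofReal] at h2
  exact_mod_cast h2

/-- `σ(1/k) = -1`. [folklore] -/
theorem scrMoeb_inv (hk0 : 0 < k) : scrMoeb k ((k⁻¹ : ℝ) : ℂ) = -1 := by
  have hkC : (k : ℂ) ≠ 0 := ofReal_ne_zero.2 hk0.ne'
  rw [scrMoeb]; push_cast; field_simp

/-- `σ(-1/k) = 1`. [folklore] -/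
theorem scrMoeb_neg_inv (hk0 : 0 < k) : scrMoeb k ((-k⁻¹ : ℝ) : ℂ) = 1 := by
  have hkC : (k : ℂ) ≠ 0 := ofReal_ne_zero.2 hk0.ne'
  rw [scrMoeb]; push_cast; field_simp

/-- **Boundary value at the prevertex `1/k`**: the corner `K + iH`. [cite: BollobasRiordan2006, Ch. 7 §7.1 p. 185] -/
theorem tendsto_scrFun_inv (hk0 : 0 < k) (hk1 : k < 1) :
    Tendsto (scrFun k) (𝓝[upperHalfPlaneSet] ((k⁻¹ : ℝ) : ℂ))
      (𝓝 ((ellipticK (k ^ 2) : ℂ) + I * (ellipticK (1 - k ^ 2) : ℂ))) := by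
  have hx : ((k⁻¹ : ℝ) : ℂ) ≠ 0 := ofReal_ne_zero.2 (inv_ne_zero hk0.ne')
  have h := tendsto_scrFun_neg_one hk0 hk1
  rw [← scrMoeb_inv hk0] at h
  have h2 := tendsto_scrFun_of_scrMoeb hk0 hk1 hx h
  rw [sub_neg_eq_add, add_comm] at h2
  exact h2

/-- **Boundary value at the prevertex `-1/k`**: the corner `-K + iH`. [cite: BollobasRiordan2006, Ch. 7 §7.1 p. 185] -/
theorem tendsto_scrFun_neg_inv (hk0 : 0 < k) (hk1 : k < 1) :
    Tendsto (scrFun k) (𝓝[upperHalfPlaneSet] ((-k⁻¹ : ℝ) : ℂ))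
      (𝓝 (-(ellipticK (k ^ 2) : ℂ) + I * (ellipticK (1 - k ^ 2) : ℂ))) := by
  have hx : ((-k⁻¹ : ℝ) : ℂ) ≠ 0 := ofReal_ne_zero.2 (neg_ne_zero.2 (inv_ne_zero hk0.ne'))
  have h := tendsto_scrFun_one hk0 hk1
  rw [← scrMoeb_neg_inv hk0] at h
  have h2 := tendsto_scrFun_of_scrMoeb hk0 hk1 hx h
  rw [sub_eq_add_neg, add_comm] at h2
  exact h2

/-- For `|x| > 1/k`, `σ x = -1/(kx) ∈ (-1, 1)`. [folklore] -/
theorem scrMoeb_ofReal_mem_Ioo (hk0 : 0 < k) {x : ℝ} (hx : k⁻¹ < |x|) :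
    -(k * x)⁻¹ ∈ Ioo (-1 : ℝ) 1 := by
  have hk : 0 < k⁻¹ := inv_pos.2 hk0
  have hx0 : x ≠ 0 := by intro h; rw [h, abs_zero] at hx; linarith
  have hkx : 1 < |k * x| := by
    rw [abs_mul, abs_of_pos hk0]
    have := mul_lt_mul_of_pos_left hx hk0
    rwa [mul_inv_cancel₀ hk0.ne'] at this
  have h1 : |(k * x)⁻¹| < 1 := by
    rw [abs_inv]; exact inv_lt_one_of_one_lt₀ hkx
  rw [abs_lt] at h1
  exact ⟨by linarith [h1.2], by linarith [h1.1]⟩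

/-- `σ x` for real `x ≠ 0`, as a real number: `-(kx)⁻¹`. [folklore] -/
theorem scrMoeb_ofReal (k x : ℝ) : scrMoeb k (x : ℂ) = ((-(k * x)⁻¹ : ℝ) : ℂ) := by
  rw [scrMoeb]; push_cast; ring

/-- **Boundary values on the top side** `|x| > 1/k`: `F_k → iH - ellipticF (k²) (-(kx)⁻¹)`
(`= iH + ellipticF (k²) ((kx)⁻¹)`, a point of the side `im = H`, `|re| < K`). [cite: BollobasRiordan2006, Ch. 7 §7.1 p. 185] -/
theorem tendsto_scrFun_of_inv_lt_abs (hk0 : 0 < k) (hk1 : k < 1) {x : ℝ} (hx : k⁻¹ < |x|) :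
    Tendsto (scrFun k) (𝓝[upperHalfPlaneSet] (x : ℂ))
      (𝓝 (I * (ellipticK (1 - k ^ 2) : ℂ) - (ellipticF (k ^ 2) (-(k * x)⁻¹) : ℂ))) := by
  have hx0 : (x : ℂ) ≠ 0 := by
    intro h; rw [ofReal_eq_zero] at h; rw [h, abs_zero] at hx; linarith [inv_pos.2 hk0]
  have h := tendsto_scrFun_ofReal hk0.le hk1.le (scrMoeb_ofReal_mem_Ioo hk0 hx)
  rw [← scrMoeb_ofReal] at h
  exact tendsto_scrFun_of_scrMoeb hk0 hk1 hx0 h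

/-- **Boundary values on the left side** `x ∈ (-1/k, -1)`: `F_k → -K + i V_k(-x)` (the reflection
of the right-side value `K + i V_k(-x)`). [cite: BollobasRiordan2006, Ch. 7 §7.1 p. 185] -/
theorem tendsto_scrFun_of_mem_Ioo_neg (hk0 : 0 < k) (hk1 : k < 1) {x : ℝ} (hx : x ∈ Ioo (-k⁻¹) (-1 : ℝ)) :
    Tendsto (scrFun k) (𝓝[upperHalfPlaneSet] (x : ℂ))
      (𝓝 (-(ellipticK (k ^ 2) : ℂ) + I * (scrV k (-x) : ℂ))) := by
  have hx' : -x ∈ Ioo (1 : ℝ) k⁻¹ := ⟨by linarith [hx.2], by linarith [hx.1]⟩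
  have h := tendsto_scrFun_of_reflect hk0.le hk1.le (tendsto_scrFun_of_mem_Ioo_one_inv hk0 hk1 hx')
  have hval : -conj ((ellipticK (k ^ 2) : ℂ) + I * (scrV k (-x) : ℂ)) =
      -(ellipticK (k ^ 2) : ℂ) + I * (scrV k (-x) : ℂ) := by
    simp [map_add, map_mul, conj_ofReal, conj_I]; ring
  rwa [hval] at h

/-! ### The anti-holomorphic symmetry `w ↦ 1/(k w̄)` and the height bound `V_k ≤ H` -/

/-- `(k w)⁻¹` lies in the doubly slit plane for `w ∈ ℍₒ` (it is in the lower half-plane). [folklore] -/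
theorem inv_mul_mem_scrDomain (hk0 : 0 < k) {w : ℂ} (hw : w ∈ upperHalfPlaneSet) :
    ((k : ℂ) * w)⁻¹ ∈ scrDomain := by
  have h := scrMoeb_mem hk0 hw
  have h' : (0 : ℝ) < (scrMoeb k w).im := h
  rw [scrMoeb, neg_im] at h'
  exact Or.inl (by linarith)

/-- **The reflection in the horizontal midline**: `F_k(1/(k w̄)) = conj F_k(w) + iH` on `ℍₒ`
(from oddness, `F_k ∘ conj = conj ∘ F_k` and the Möbius symmetry). [folklore] -/
theorem scrFun_inv_conj (hk0 : 0 < k) (hk1 : k < 1) {w : ℂ} (hw : w ∈ upperHalfPlaneSet) :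
    scrFun k (((k : ℂ) * conj w)⁻¹) = conj (scrFun k w) + I * (ellipticK (1 - k ^ 2) : ℂ) := by
  have h1 : ((k : ℂ) * conj w)⁻¹ = conj (((k : ℂ) * w)⁻¹) := by simp [conj_ofReal]
  have h2 : ((k : ℂ) * w)⁻¹ = -scrMoeb k w := by rw [scrMoeb, neg_neg]
  rw [h1, scrFun_conj hk0.le hk1.le (inv_mul_mem_scrDomain hk0 hw), h2, scrFun_neg,
    show scrFun k (scrMoeb k w) = I * (ellipticK (1 - k ^ 2) : ℂ) - scrFun k w by
      rw [← scrFun_scrMoeb_add hk0 hk1 hw]; ring]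
  simp only [map_neg, map_sub, map_mul, conj_I, conj_ofReal]
  ring

/-- `w ↦ 1/(k w̄)` maps `ℍₒ` into itself. [folklore] -/
theorem inv_mul_conj_mem (hk0 : 0 < k) {w : ℂ} (hw : w ∈ upperHalfPlaneSet) :
    ((k : ℂ) * conj w)⁻¹ ∈ upperHalfPlaneSet := by
  have h1 : ((k : ℂ) * conj w)⁻¹ = -conj (scrMoeb k w) := by simp [scrMoeb, conj_ofReal]
  rw [h1]
  exact neg_conj_mem_upperHalfPlaneSet (scrMoeb_mem hk0 hw)

/-- `1/(k w̄) → 1/(k x)` within `ℍₒ` as `w → x` (`x ≠ 0` real) within `ℍₒ`. [folklore] -/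
theorem tendsto_inv_mul_conj_nhdsWithin (hk0 : 0 < k) {x : ℝ} (hx : x ≠ 0) :
    Tendsto (fun w : ℂ => ((k : ℂ) * conj w)⁻¹) (𝓝[upperHalfPlaneSet] (x : ℂ))
      (𝓝[upperHalfPlaneSet] (((k * x)⁻¹ : ℝ) : ℂ)) := by
  refine tendsto_nhdsWithin_of_tendsto_nhds_of_eventually_within _ ?_ ?_
  · have hc : ContinuousAt (fun w : ℂ => ((k : ℂ) * conj w)⁻¹) (x : ℂ) := by
      refine ((continuous_const.mul continuous_conj).continuousAt).inv₀ ?_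
      simp [conj_ofReal, hk0.ne', hx]
    have := hc.tendsto
    rw [show ((k : ℂ) * conj (x : ℂ))⁻¹ = (((k * x)⁻¹ : ℝ) : ℂ) by simp [conj_ofReal] ] at this
    exact this.mono_left nhdsWithin_le_nhds
  · exact eventually_mem_nhdsWithin.mono fun w hw => inv_mul_conj_mem hk0 hw

/-- **The height relation on the right side**: `V_k(x) + V_k(1/(kx)) = H` for `x ∈ (1, 1/k)` (the
reflection `w ↦ 1/(k w̄)` exchanges the boundary points `x` and `1/(kx)` of `(1, 1/k)` and reflects the
right side of the rectangle in its midpoint `K + iH/2`). [folklore] -/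
theorem scrV_add_scrV_inv (hk0 : 0 < k) (hk1 : k < 1) {x : ℝ} (hx : x ∈ Ioo (1 : ℝ) k⁻¹) :
    scrV k x + scrV k (k * x)⁻¹ = ellipticK (1 - k ^ 2) := by
  have hx0 : x ≠ 0 := by linarith [hx.1]
  have hkx : 0 < k * x := mul_pos hk0 (by linarith [hx.1])
  have hx' : (k * x)⁻¹ ∈ Ioo (1 : ℝ) k⁻¹ := by
    constructor
    · rw [lt_inv_comm₀ zero_lt_one hkx, inv_one]
      calc k * x < k * k⁻¹ := mul_lt_mul_of_pos_left hx.2 hk0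
        _ = 1 := mul_inv_cancel₀ hk0.ne'
    · rw [mul_inv]
      calc k⁻¹ * x⁻¹ < k⁻¹ * 1 := mul_lt_mul_of_pos_left (inv_lt_one_of_one_lt₀ hx.1) (inv_pos.2 hk0)
        _ = k⁻¹ := mul_one _
  haveI := neBot_nhdsWithin_upperHalfPlaneSet x
  -- the two limits of `F_k(1/(k w̄))` as `w → x`
  have hA := (tendsto_scrFun_of_mem_Ioo_one_inv hk0 hk1 hx').comp (tendsto_inv_mul_conj_nhdsWithin hk0 hx0)
  have hB : Tendsto (fun w : ℂ => scrFun k (((k : ℂ) * conj w)⁻¹)) (𝓝[upperHalfPlaneSet] (x : ℂ))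
      (𝓝 (conj ((ellipticK (k ^ 2) : ℂ) + I * (scrV k x : ℂ)) + I * (ellipticK (1 - k ^ 2) : ℂ))) := by
    have h := ((continuous_conj.tendsto _).comp (tendsto_scrFun_of_mem_Ioo_one_inv hk0 hk1 hx)).add
      (tendsto_const_nhds (x := I * (ellipticK (1 - k ^ 2) : ℂ)))
    exact h.congr' (eventually_mem_nhdsWithin.mono fun w hw => (scrFun_inv_conj hk0 hk1 hw).symm)
  have heq := tendsto_nhds_unique hA hB
  have him := congrArg Complex.im heq
  simp only [add_im, mul_im, I_re, I_im, ofReal_re, ofReal_im, conj_im, one_mul, zero_add,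
    mul_zero] at him
  linarith

/-- **The height bound**: `0 ≤ V_k(x) ≤ H` for `x ∈ (1, 1/k)`. [folklore] -/
theorem scrV_le (hk0 : 0 < k) (hk1 : k < 1) {x : ℝ} (hx : x ∈ Ioo (1 : ℝ) k⁻¹) :
    scrV k x ≤ ellipticK (1 - k ^ 2) := by
  have hkx : 0 < k * x := mul_pos hk0 (by linarith [hx.1])
  have hx' : (k * x)⁻¹ ∈ Ico (1 : ℝ) k⁻¹ := by
    constructor
    · rw [le_inv_comm₀ zero_lt_one hkx, inv_one]
      calc k * x ≤ k * k⁻¹ := (mul_lt_mul_of_pos_left hx.2 hk0).le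
        _ = 1 := mul_inv_cancel₀ hk0.ne'
    · rw [mul_inv]
      calc k⁻¹ * x⁻¹ < k⁻¹ * 1 := mul_lt_mul_of_pos_left (inv_lt_one_of_one_lt₀ hx.1) (inv_pos.2 hk0)
        _ = k⁻¹ := mul_one _
  have h := scrV_add_scrV_inv hk0 hk1 hx
  linarith [scrV_nonneg hk0 hk1 hx']

end Literature.Probability.RandomPlanarGeometry

end
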